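import Mathlib
import HarnessLib
import Summits.HubbardSuperconductivity.HubbardSuperconductivity.Theorems.KLProgrammeC4aCausticWindowDispatch
import Summits.HubbardSuperconductivity.HubbardSuperconductivity.Theorems.KLProgrammeC4aCausticAngleLayer

/-!
# Route `KLProgramme` — crux C4a, S3 brick (B4) «(B4)-UMK1», «(M2)-DISPATCH» part 3: the TRANSVERSAL caustic window on a FIXED ϑ-window — the crossing point
# is internal (two-point separation + continuity ⇒ a sign point `e` with `κ₁|ϑ − e| ≤ |δ₀(ϑ)|` everywhere, zero OR edge), the two-sided law is asked in the
# currency `|δ₀(ϑ)|` only, so the (U1) assembly never locates the crossing `ϑ_G` of `…C4aCausticAngleLayer` either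

Cell `gate-hubbard-kl`, seat hubbard-kl-k3c3-p3 (g29; row «implicit-function / monotonicity route for μ(n)»).  Located brick for the (C)-closer lane hubbard-kl-c4a-1
(stub (C) `stub_twoLeg_curvature` of `KLRegimeEngineV17F2`, stmt-HubbardSuperconductivity-20437), memo HOME/hubbard-kl-k3c3-p3/U1-CAUSTIC-SUP.md §4 (P2-true)/(M4).
Companion of parts 1–2 (`…C4aCausticSignPair`, `…C4aCausticWindowDispatch`: the CONVEX windows near an antipodal-umklapp touch).  On the TRANSVERSAL windows
(`…C4aCausticOffsetRate`: `κ₁|ϑ − ϑ′| ≤ |δ₀(ϑ) − δ₀(ϑ′)|` from the Gauss-law floor and the monotone drift of the fold value) the landed layer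
`…C4aCausticAngleLayer.intervalIntegral_caustic_window_le` is keyed to a located crossing `c` and a symmetric window `[c − δ, c + δ]`.  This file:
* §1 **`exists_signPoint_of_separation`**: `m` continuous on `[α,β]` with the two-point separation `κ₁|ϑ − ϑ′| ≤ |m ϑ − m ϑ′|` ⟹ a point `e ∈ [α,β]` with
  `κ₁|ϑ − e| ≤ |m ϑ|` on the window (a zero if the sign changes — unique; otherwise the end where `|m|` is least: constant sign by the intermediate value
  theorem, then the separation from the extremal point) — no monotonicity hypothesis, no implicit function;
* §2 **`intervalIntegral_caustic_dispatch_transversal_le`**: fixed window `[α,β]`, `F ≥ 0`, the two-sided first-order law in offset currency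
  `F ϑ ≤ A₁(1 + log⁺(Γ/|m ϑ|))²(1 + 1/√|m ϑ|)` WHERE `m ϑ ≠ 0` (points of `Ioo α β`), `κ₁(β − α) ≤ Γ` ⟹
  `∫_α^β F ≤ 2·A₁·max(1, 1/√κ₁)·81·(Γ/κ₁)^{1/4}·((β−α)^{3/4}/(3/4) + (β−α)^{1/4}/(1/4))` — the crossing never reaches the caller.
With parts 1–2 every ϑ-window of the (M4) assembly is ONE call keyed to the SIGN/size of `δ₀(ϑ)`: transversal windows here, convex windows there.
Pure real analysis; nothing about the model; nothing asserts (C), K3 or superconductivity.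
References: Salmhofer 1999 §4.5.3 [cite: Salmhofer1999]; FST II CPAM 51 (1998) §3 [cite: FeldmanSalmhoferTrubowitz1998].
-/

noncomputable section

namespace Summit.HubbardSuperconductivity.HubbardSuperconductivity.Theorems.C4a

set_option linter.dupNamespace false -- summit = problem name (single-conjunct summit), D-0017

open Real Set MeasureTheory intervalIntegral

/-! ## §1 The sign point of a separated continuous offset -/

/-- **THE SIGN POINT.**  `α ≤ β`, `0 < κ₁`, `m` continuous on `[α,β]` with `κ₁|ϑ − ϑ′| ≤ |m ϑ − m ϑ′|` for all `ϑ, ϑ′` in the window.  THEN there is `e ∈ [α,β]`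
with `κ₁|ϑ − e| ≤ |m ϑ|` for every `ϑ ∈ [α,β]` (if `m` vanishes at `e` this is the separation; otherwise `m` has constant sign by the intermediate value theorem
and `e` is the point where `|m|` is least). -/
theorem exists_signPoint_of_separation {m : ℝ → ℝ} {α β κ₁ : ℝ} (hαβ : α ≤ β) (hcont : ContinuousOn m (Icc α β))
    (hsep : ∀ ϑ ∈ Icc α β, ∀ ϑ' ∈ Icc α β, κ₁ * |ϑ - ϑ'| ≤ |m ϑ - m ϑ'|) :
    ∃ e ∈ Icc α β, ∀ ϑ ∈ Icc α β, κ₁ * |ϑ - e| ≤ |m ϑ| := by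
  by_cases hz : ∃ e ∈ Icc α β, m e = 0
  · obtain ⟨e, he, he0⟩ := hz
    refine ⟨e, he, fun ϑ hϑ => ?_⟩
    have h := hsep ϑ hϑ e he
    rwa [he0, sub_zero] at h
  push Not at hz
  -- no zero: constant sign (IVT), and the extremal point works
  obtain ⟨cmin, hcminI, hcmin⟩ := isCompact_Icc.exists_isMinOn (nonempty_Icc.2 hαβ) hcont
  obtain ⟨cmax, hcmaxI, hcmax⟩ := isCompact_Icc.exists_isMaxOn (nonempty_Icc.2 hαβ) hcont
  have hmin' : ∀ x ∈ Icc α β, m cmin ≤ m x := fun x hx => isMinOn_iff.1 hcmin x hx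
  have hmax' : ∀ x ∈ Icc α β, m x ≤ m cmax := fun x hx => isMaxOn_iff.1 hcmax x hx
  -- `0` is not a value: either `0 < m cmin` or `m cmax < 0`
  have hsign : 0 < m cmin ∨ m cmax < 0 := by
    by_contra hcon
    push Not at hcon
    obtain ⟨h1, h2⟩ := hcon
    have hpc : IsPreconnected (Icc α β) := isPreconnected_Icc
    have himg := hpc.intermediate_value hcminI hcmaxI hcont
    obtain ⟨z, hz', hz0⟩ := himg ⟨h1, h2⟩
    exact hz z hz' hz0
  rcases hsign with hpos | hneg
  · refine ⟨cmin, hcminI, fun ϑ hϑ => ?_⟩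
    have h := hsep ϑ hϑ cmin hcminI
    have hd : 0 ≤ m ϑ - m cmin := sub_nonneg.2 (hmin' ϑ hϑ)
    rw [abs_of_nonneg hd] at h
    rw [abs_of_pos (lt_of_lt_of_le hpos (hmin' ϑ hϑ))]
    linarith
  · refine ⟨cmax, hcmaxI, fun ϑ hϑ => ?_⟩
    have h := hsep ϑ hϑ cmax hcmaxI
    have hd : m ϑ - m cmax ≤ 0 := sub_nonpos.2 (hmax' ϑ hϑ)
    rw [abs_of_nonpos hd] at h
    rw [abs_of_neg (lt_of_le_of_lt (hmax' ϑ hϑ) hneg)]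
    linarith

/-! ## §2 The transversal dispatcher -/

/-- The caustic majorant in offset currency: `0 < κ₁`, `κ₁ x ≤ |y|`, `0 < x ≤ Γ/κ₁` ⟹
`(1 + log⁺(Γ/|y|))²(1 + (√|y|)⁻¹) ≤ max(1, (√κ₁)⁻¹)·81·(Γ/κ₁)^{1/4}·(x^{−1/4} + x^{−3/4})`. -/
theorem caustic_majorant_offset_le {κ₁ Γ x y : ℝ} (hκ₁ : 0 < κ₁) (hx : 0 < x) (hxΓ : x ≤ Γ / κ₁) (hy : κ₁ * x ≤ |y|) :
    (1 + log⁺ (Γ / |y|)) ^ 2 * (1 + (Real.sqrt |y|)⁻¹) ≤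
      max 1 (Real.sqrt κ₁)⁻¹ * (81 * (Γ / κ₁) ^ (1 / 4 : ℝ) * (x ^ (-(1 / 4) : ℝ) + x ^ (-(3 / 4) : ℝ))) := by
  have hκx : 0 < κ₁ * x := mul_pos hκ₁ hx
  have hypos : 0 < |y| := lt_of_lt_of_le hκx hy
  have hΓ : 0 ≤ Γ := by
    have : 0 ≤ Γ / κ₁ := hx.le.trans hxΓ
    have h := mul_nonneg this hκ₁.le
    rwa [div_mul_cancel₀ _ hκ₁.ne'] at h
  set M : ℝ := max 1 (Real.sqrt κ₁)⁻¹ with hM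
  have hM1 : 1 ≤ M := le_max_left _ _
  have hM2 : (Real.sqrt κ₁)⁻¹ ≤ M := le_max_right _ _
  -- the logarithm: `Γ/|y| ≤ Γ/(κ₁ x) = (Γ/κ₁)/x`
  have hlog : log⁺ (Γ / |y|) ≤ log⁺ (Γ / κ₁ / x) := by
    refine Real.posLog_le_posLog (div_nonneg hΓ hypos.le) ?_
    rw [div_div]
    exact div_le_div_of_nonneg_left hΓ hκx hy
  have h1 : (1 + log⁺ (Γ / |y|)) ^ 2 ≤ (1 + log⁺ (Γ / κ₁ / x)) ^ 2 := by
    have : 0 ≤ 1 + log⁺ (Γ / |y|) := by have := Real.posLog_nonneg (x := Γ / |y|); linarith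
    exact pow_le_pow_left₀ this (by linarith) 2
  -- the square root: `(√|y|)⁻¹ ≤ (√(κ₁x))⁻¹ = (√κ₁)⁻¹ (√x)⁻¹ ≤ M (√x)⁻¹`
  have h2 : (Real.sqrt |y|)⁻¹ ≤ M * (Real.sqrt x)⁻¹ := by
    have hs : Real.sqrt (κ₁ * x) ≤ Real.sqrt |y| := Real.sqrt_le_sqrt hy
    have hs0 : 0 < Real.sqrt (κ₁ * x) := Real.sqrt_pos.2 hκx
    calc (Real.sqrt |y|)⁻¹ ≤ (Real.sqrt (κ₁ * x))⁻¹ := inv_anti₀ hs0 hs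
      _ = (Real.sqrt κ₁)⁻¹ * (Real.sqrt x)⁻¹ := by rw [Real.sqrt_mul hκ₁.le, mul_inv]
      _ ≤ M * (Real.sqrt x)⁻¹ := mul_le_mul_of_nonneg_right hM2 (inv_nonneg.2 (Real.sqrt_nonneg _))
  have h3 : 1 + (Real.sqrt |y|)⁻¹ ≤ M * (1 + (Real.sqrt x)⁻¹) := by
    have : 0 ≤ (Real.sqrt x)⁻¹ := inv_nonneg.2 (Real.sqrt_nonneg _)
    nlinarith [h2, hM1]
  have h4 := caustic_majorant_le (Γ := Γ / κ₁) hx hxΓ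
  have hA : 0 ≤ (1 + log⁺ (Γ / κ₁ / x)) ^ 2 := sq_nonneg _
  have hB : 0 ≤ 1 + (Real.sqrt |y|)⁻¹ := by positivity
  have hM0 : 0 ≤ M := zero_le_one.trans hM1
  calc (1 + log⁺ (Γ / |y|)) ^ 2 * (1 + (Real.sqrt |y|)⁻¹)
      ≤ (1 + log⁺ (Γ / κ₁ / x)) ^ 2 * (1 + (Real.sqrt |y|)⁻¹) := mul_le_mul_of_nonneg_right h1 hB
    _ ≤ (1 + log⁺ (Γ / κ₁ / x)) ^ 2 * (M * (1 + (Real.sqrt x)⁻¹)) := mul_le_mul_of_nonneg_left h3 hA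
    _ = M * ((1 + log⁺ (Γ / κ₁ / x)) ^ 2 * (1 + (Real.sqrt x)⁻¹)) := by ring
    _ ≤ M * (81 * (Γ / κ₁) ^ (1 / 4 : ℝ) * (x ^ (-(1 / 4) : ℝ) + x ^ (-(3 / 4) : ℝ))) := mul_le_mul_of_nonneg_left h4 hM0

/-- **THE TRANSVERSAL DISPATCHER.**  Fixed window `α ≤ β`; `0 < κ₁`, `0 ≤ A₁`, `κ₁(β − α) ≤ Γ`; `m` continuous on `[α,β]` with the two-point separation
`κ₁|ϑ − ϑ′| ≤ |m ϑ − m ϑ′|` (`…C4aCausticOffsetRate.abs_min_value_sub_ge`); `F ≥ 0` on `[α,β]`; at points of `Ioo α β` with `m ϑ ≠ 0` the TWO-SIDED first-order law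
in offset currency `F ϑ ≤ A₁(1 + log⁺(Γ/|m ϑ|))²(1 + (√|m ϑ|)⁻¹)` (`…C4aFoldLevelLayer`-shape).  THEN
`∫_α^β F ≤ 2·(A₁·max(1,(√κ₁)⁻¹)·81·(Γ/κ₁)^{1/4}·((β−α)^{3/4}/(3/4) + (β−α)^{1/4}/(1/4)))` — the crossing (a zero of `m` or none) is internal. -/
theorem intervalIntegral_caustic_dispatch_transversal_le {F m : ℝ → ℝ} {α β κ₁ Γ A₁ : ℝ} (hαβ : α ≤ β) (hκ₁ : 0 < κ₁) (hA₁ : 0 ≤ A₁)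
    (hΓ : κ₁ * (β - α) ≤ Γ) (hcont : ContinuousOn m (Icc α β))
    (hsep : ∀ ϑ ∈ Icc α β, ∀ ϑ' ∈ Icc α β, κ₁ * |ϑ - ϑ'| ≤ |m ϑ - m ϑ'|)
    (hF0 : ∀ ϑ ∈ Icc α β, 0 ≤ F ϑ)
    (hF : ∀ ϑ ∈ Ioo α β, m ϑ ≠ 0 → F ϑ ≤ A₁ * ((1 + log⁺ (Γ / |m ϑ|)) ^ 2 * (1 + (Real.sqrt |m ϑ|)⁻¹))) :
    ∫ ϑ in α..β, F ϑ ≤ 2 * (A₁ * max 1 (Real.sqrt κ₁)⁻¹ * (81 * (Γ / κ₁) ^ (1 / 4 : ℝ)) *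
      ((β - α) ^ (3 / 4 : ℝ) / (3 / 4) + (β - α) ^ (1 / 4 : ℝ) / (1 / 4))) := by
  obtain ⟨e, heI, he⟩ := exists_signPoint_of_separation hαβ hcont hsep
  set M : ℝ := max 1 (Real.sqrt κ₁)⁻¹ with hM
  have hM0 : 0 ≤ M := zero_le_one.trans (le_max_left _ _)
  have hΓκ : 0 ≤ Γ / κ₁ := div_nonneg ((mul_nonneg hκ₁.le (sub_nonneg.2 hαβ)).trans hΓ) hκ₁.le
  set C : ℝ := A₁ * M * (81 * (Γ / κ₁) ^ (1 / 4 : ℝ)) with hC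
  have hC0 : 0 ≤ C := by
    have : 0 ≤ (Γ / κ₁) ^ (1 / 4 : ℝ) := Real.rpow_nonneg hΓκ _
    positivity
  -- the majorant in distance form and its half-window integral
  set maj : ℝ → ℝ := fun x => C * (x ^ (-(1 / 4) : ℝ) + x ^ (-(3 / 4) : ℝ)) with hmaj
  have hmaj_int : ∀ p q : ℝ, IntervalIntegrable maj volume p q := fun p q =>
    ((intervalIntegral.intervalIntegrable_rpow' (by norm_num)).add (intervalIntegral.intervalIntegrable_rpow' (by norm_num))).const_mul C
  have hmaj_val : ∀ L : ℝ, 0 ≤ L → L ≤ β - α →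
      ∫ x in (0 : ℝ)..L, maj x ≤ C * ((β - α) ^ (3 / 4 : ℝ) / (3 / 4) + (β - α) ^ (1 / 4 : ℝ) / (1 / 4)) := fun L hL hLβ => by
    simp only [hmaj]
    rw [intervalIntegral.integral_const_mul, intervalIntegral.integral_add (intervalIntegral.intervalIntegrable_rpow' (by norm_num))
      (intervalIntegral.intervalIntegrable_rpow' (by norm_num)), integral_rpow_neg_quarter, integral_rpow_neg_three_quarters]
    refine mul_le_mul_of_nonneg_left ?_ hC0
    have h1 : L ^ (3 / 4 : ℝ) ≤ (β - α) ^ (3 / 4 : ℝ) := Real.rpow_le_rpow hL hLβ (by norm_num)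
    have h2 : L ^ (1 / 4 : ℝ) ≤ (β - α) ^ (1 / 4 : ℝ) := Real.rpow_le_rpow hL hLβ (by norm_num)
    have : L ^ (3 / 4 : ℝ) / (3 / 4) ≤ (β - α) ^ (3 / 4 : ℝ) / (3 / 4) := div_le_div_of_nonneg_right h1 (by norm_num)
    have : L ^ (1 / 4 : ℝ) / (1 / 4) ≤ (β - α) ^ (1 / 4 : ℝ) / (1 / 4) := div_le_div_of_nonneg_right h2 (by norm_num)
    linarith
  -- pointwise: off `e`, `F ϑ ≤ maj |ϑ − e|`
  have hpt : ∀ ϑ ∈ Ioo α β, ϑ ≠ e → F ϑ ≤ maj |ϑ - e| := fun ϑ hϑ hne => by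
    have hϑI : ϑ ∈ Icc α β := Ioo_subset_Icc_self hϑ
    have hx : 0 < |ϑ - e| := abs_pos.2 (sub_ne_zero.2 hne)
    have hxβ : |ϑ - e| ≤ β - α := by
      rw [abs_le]; constructor <;> linarith [hϑI.1, hϑI.2, heI.1, heI.2]
    have hxΓ : |ϑ - e| ≤ Γ / κ₁ := by
      rw [le_div_iff₀ hκ₁]
      calc |ϑ - e| * κ₁ = κ₁ * |ϑ - e| := mul_comm _ _
        _ ≤ κ₁ * (β - α) := mul_le_mul_of_nonneg_left hxβ hκ₁.le
        _ ≤ Γ := hΓ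
    have hfl := he ϑ hϑI
    have hm0 : m ϑ ≠ 0 := fun h0 => by
      rw [h0, abs_zero] at hfl
      exact absurd hfl (not_le.2 (mul_pos hκ₁ hx))
    have h1 := hF ϑ hϑ hm0
    have h2 := caustic_majorant_offset_le (Γ := Γ) hκ₁ hx hxΓ hfl
    simp only [hmaj, hC]
    calc F ϑ ≤ A₁ * ((1 + log⁺ (Γ / |m ϑ|)) ^ 2 * (1 + (Real.sqrt |m ϑ|)⁻¹)) := h1
      _ ≤ A₁ * (M * (81 * (Γ / κ₁) ^ (1 / 4 : ℝ) * (|ϑ - e| ^ (-(1 / 4) : ℝ) + |ϑ - e| ^ (-(3 / 4) : ℝ)))) :=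
          mul_le_mul_of_nonneg_left h2 hA₁
      _ = A₁ * M * (81 * (Γ / κ₁) ^ (1 / 4 : ℝ)) * (|ϑ - e| ^ (-(1 / 4) : ℝ) + |ϑ - e| ^ (-(3 / 4) : ℝ)) := by ring
  -- right piece `[e, β]`
  have hpR : ∫ ϑ in e..β, F ϑ ≤ C * ((β - α) ^ (3 / 4 : ℝ) / (3 / 4) + (β - α) ^ (1 / 4 : ℝ) / (1 / 4)) := by
    have hmi : IntervalIntegrable (fun ϑ => maj (ϑ - e)) volume e β := by
      have h := (hmaj_int (e - e) (β - e)).comp_sub_right e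
      simp only [sub_add_cancel] at h
      exact h
    have hle := intervalIntegral_le_of_majorant_Ioo (R := fun _ => 0) heI.2 (fun ϑ hϑ => hF0 ϑ ⟨heI.1.trans hϑ.1.le, hϑ.2.le⟩) hmi
      intervalIntegrable_const (fun ϑ hϑ => by
        have hx : 0 < ϑ - e := sub_pos.2 hϑ.1
        have h := hpt ϑ ⟨lt_of_le_of_lt heI.1 hϑ.1, hϑ.2⟩ (ne_of_gt hϑ.1)
        rw [abs_of_pos hx] at h
        simpa using h)
    refine hle.trans ?_
    rw [intervalIntegral.integral_comp_sub_right maj e, sub_self, intervalIntegral.integral_const, smul_zero, add_zero]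
    exact hmaj_val (β - e) (sub_nonneg.2 heI.2) (by linarith [heI.1])
  -- left piece `[α, e]`
  have hpL : ∫ ϑ in α..e, F ϑ ≤ C * ((β - α) ^ (3 / 4 : ℝ) / (3 / 4) + (β - α) ^ (1 / 4 : ℝ) / (1 / 4)) := by
    have hmi : IntervalIntegrable (fun ϑ => maj (e - ϑ)) volume α e := by
      have h := ((hmaj_int (e - e) (e - α)).comp_sub_left e).symm
      simp only [sub_sub_cancel, sub_self, sub_zero] at h
      exact h
    have hle := intervalIntegral_le_of_majorant_Ioo (R := fun _ => 0) heI.1 (fun ϑ hϑ => hF0 ϑ ⟨hϑ.1.le, hϑ.2.le.trans heI.2⟩) hmi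
      intervalIntegrable_const (fun ϑ hϑ => by
        have hx : 0 < e - ϑ := sub_pos.2 hϑ.2
        have h := hpt ϑ ⟨hϑ.1, lt_of_lt_of_le hϑ.2 heI.2⟩ (ne_of_lt hϑ.2)
        rw [abs_sub_comm, abs_of_pos hx] at h
        simpa using h)
    refine hle.trans ?_
    rw [intervalIntegral.integral_comp_sub_left maj e, sub_self, intervalIntegral.integral_const, smul_zero, add_zero]
    exact hmaj_val (e - α) (sub_nonneg.2 heI.1) (by linarith [heI.2])
  -- assemble
  by_cases hint : IntervalIntegrable F volume α β
  swap
  · rw [intervalIntegral.integral_undef hint]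
    have : 0 ≤ (β - α) ^ (3 / 4 : ℝ) / (3 / 4) + (β - α) ^ (1 / 4 : ℝ) / (1 / 4) := by
      have h1 : 0 ≤ (β - α) ^ (3 / 4 : ℝ) := Real.rpow_nonneg (sub_nonneg.2 hαβ) _
      have h2 : 0 ≤ (β - α) ^ (1 / 4 : ℝ) := Real.rpow_nonneg (sub_nonneg.2 hαβ) _
      positivity
    have h3 : 0 ≤ (Γ / κ₁) ^ (1 / 4 : ℝ) := Real.rpow_nonneg hΓκ _
    positivity
  have hi1 : IntervalIntegrable F volume α e :=
    hint.mono_set (by rw [uIcc_of_le heI.1, uIcc_of_le hαβ]; exact Icc_subset_Icc le_rfl heI.2)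
  have hi2 : IntervalIntegrable F volume e β :=
    hint.mono_set (by rw [uIcc_of_le heI.2, uIcc_of_le hαβ]; exact Icc_subset_Icc heI.1 le_rfl)
  rw [← integral_add_adjacent_intervals hi1 hi2]
  linarith [hpL, hpR]

end Summit.HubbardSuperconductivity.HubbardSuperconductivity.Theorems.C4a

end
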